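import Mathlib
import Literature.NumberTheory.Sieve.ShiuTheoremProofs
import Literature.NumberTheory.Sieve.PolynomialValuesSieveBounds
import Literature.NumberTheory.Sieve.SieveFrameworkUpperBound
import Literature.NumberTheory.Sieve.BoundedClassDensitySieveDimension
import Literature.NumberTheory.Sieve.PolynomialCongruencesMeanValues
import Literature.NumberTheory.Sieve.DivisorBound
import Literature.NumberTheory.LFunctions.MertensElementary
import Summits.Parity.BatemanHorn.Theorems.AlmostPrimeZerosSystemMertensCounting
import HarnessLib

/-!
# Nair–Tenenbaum light, III: the counting engine (upper-bound sieve on the root classes of `c`)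

Crux `SystemLSDRealSegment` (stmt-Parity-11292, route `AlmostPrimeZeros`), line `beta-thinned-root-kernel`,
support programme of the lead c8: **Nair–Tenenbaum "light"** — the sharp-order upper bound
`Σ_{1≤n≤N} G(F(n)) ≤ C · N · exp(Σ_{p≤N} (G(p) − 1) ρ_F(p)/p)` for a polynomial `F ∈ ℤ[X]` (degree `≥ 1`, positive on
`ℕ_{≥1}`, root counts `ρ_F(p) ≤ D`, `ρ_F(p) < p`, `ρ_F(p^a) ≤ M`) and every weight `G ≥ 0`, `G(1) = 1`, multiplicative on
coprime arguments with `G(p^v) ≤ A` (M. Nair, Acta Arith. 62 (1992); Nair–Tenenbaum, Acta Math. 180 (1998), Thm 1 —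
the special case of the class bounded at prime powers), by Shiu's method (J. reine angew. Math. 313 (1980), §5) run on the
values `m = F(n)`: cut `m = c·d` at `√N` (`Shiu.cutPrime/cPart/dPart`), four classes, the beta upper-bound sieve of dimension
`2D` on the root classes of `c`, Hall–Tenenbaum's Theorem 01 and Rankin's trick with a uniform exponent for the `c`-sums.
Applied (file `…NairUpperBound`) to the product polynomial of a Bateman–Horn system with `G = y^{capped}` it gives
`Σ_{n≤x} y^{s_f(n)} ≪ x (log x)^{k(y−1)}`, i.e. `H_x(y) = O(1)` on the real segment — the upper half of the order of
magnitude predicted by the crux (lower half: `sumPowStat_lower_bound`, landed).  Everything here is PROVED; no definitions.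

This file: `#{n ≤ N : c ∣ F(n), p ∤ F(n) (p < w, p ∤ c)} ≤ K₁ (N/c) ρ(c) ∏_{p<w,p∤c}(1−ρ(p)/p) + K₂ ρ(c) w^{18D+1}(log w)^D`.
-/

open Finset Real Polynomial

namespace Summit.Parity.BatemanHorn.Cruxes.SystemLSDRealSegment.BetaThinnedRootKernel.Nair

open Literature.NumberTheory.Sieve

noncomputable section

/-! ## Part B. The counting engine: multiples of `c` among the values, sifted by the primes `< w` not dividing `c` -/

section Engine

variable (F : ℤ[X]) {D : ℕ}

/-- `∏_{p<z} (1 + ρ(p)/p) ≤ e^{4D} (log z)^D` for `z ≥ 2` when `ρ(p) ≤ D`. [folklore] -/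
theorem prod_one_add_rootDensity_le_gen (hD : ∀ p : ℕ, p.Prime → polyRootCountMod ![F] p ≤ D)
    {z : ℝ} (hz : 2 ≤ z) :
    ∏ p ∈ Nat.primesBelow ⌈z⌉₊, (1 + rootDensity F p) ≤ Real.exp (4 * D) * Real.log z ^ D := by
  have hlogz : 0 < Real.log z := Real.log_pos (by linarith)
  calc ∏ p ∈ Nat.primesBelow ⌈z⌉₊, (1 + rootDensity F p)
      ≤ ∏ p ∈ Nat.primesBelow ⌈z⌉₊, Real.exp ((D : ℝ) * (1 / (p : ℝ))) := by
        refine Finset.prod_le_prod (fun p _ => ?_) (fun p hp => ?_)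
        · linarith [rootDensity_nonneg F p]
        · have hpp := Nat.prime_of_mem_primesBelow hp
          have hp0 : (0 : ℝ) < p := by exact_mod_cast hpp.pos
          have hg : rootDensity F p ≤ (D : ℝ) * (1 / (p : ℝ)) := by
            rw [rootDensity_apply, mul_one_div]
            exact div_le_div_of_nonneg_right (by exact_mod_cast hD p hpp) hp0.le
          linarith [Real.add_one_le_exp ((D : ℝ) * (1 / (p : ℝ)))]
    _ = Real.exp ((D : ℝ) * ∑ p ∈ Nat.primesBelow ⌈z⌉₊, (1 : ℝ) / p) := by
        rw [Finset.mul_sum, Real.exp_sum]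
    _ ≤ Real.exp ((D : ℝ) * (Real.log (Real.log z) + 4)) :=
        Real.exp_le_exp.mpr (mul_le_mul_of_nonneg_left (sum_primesBelow_one_div_le hz)
          (Nat.cast_nonneg D))
    _ = Real.exp (4 * D) * Real.log z ^ D := by
        rw [show (D : ℝ) * (Real.log (Real.log z) + 4) = 4 * D + D * Real.log (Real.log z) by ring,
          Real.exp_add, Real.exp_nat_mul, Real.exp_log hlogz]

/-- **The remainder sum** (Rankin's trick) for a sifting set `P ∣ P(z)`: for `L ≥ 0`, `z ≥ 2` and
`ρ(p) ≤ D`, `∑_{m ∣ P, m ≤ L} ρ(m) ≤ L ∑_{m ∣ P} ρ(m)/m = L ∏_{p ∣ P} (1 + ρ(p)/p)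
≤ L e^{4D} (log z)^D`. [folklore] -/
theorem sum_rootCount_divisors_le_gen (hD : ∀ p : ℕ, p.Prime → polyRootCountMod ![F] p ≤ D)
    {z L : ℝ} (hz : 2 ≤ z) (hL : 0 ≤ L) {P : ℕ} (hP : P ∣ primesProdBelow z) :
    ∑ m ∈ P.divisors.filter (fun m : ℕ => (m : ℝ) ≤ L), (polyRootCountMod ![F] m : ℝ) ≤
      L * (Real.exp (4 * D) * Real.log z ^ D) := by
  have hPsq : Squarefree P := (squarefree_primesProdBelow z).squarefree_of_dvd hP
  have hsub : P.primeFactors ⊆ Nat.primesBelow ⌈z⌉₊ := by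
    rw [← primeFactors_primesProdBelow]
    exact Nat.primeFactors_mono hP (primesProdBelow_ne_zero z)
  calc ∑ m ∈ P.divisors.filter (fun m : ℕ => (m : ℝ) ≤ L), (polyRootCountMod ![F] m : ℝ)
      ≤ ∑ m ∈ P.divisors.filter (fun m : ℕ => (m : ℝ) ≤ L), L * rootDensity F m := by
        refine Finset.sum_le_sum fun m hm => ?_
        obtain ⟨hmd, hmL⟩ := Finset.mem_filter.mp hm
        have hm0 : (0 : ℝ) < m := by exact_mod_cast Nat.pos_of_mem_divisors hmd
        rw [rootDensity_apply]
        calc (polyRootCountMod ![F] m : ℝ) = (polyRootCountMod ![F] m : ℝ) / m * m := by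
              field_simp
          _ ≤ (polyRootCountMod ![F] m : ℝ) / m * L :=
              mul_le_mul_of_nonneg_left hmL (by positivity)
          _ = L * ((polyRootCountMod ![F] m : ℝ) / m) := by ring
    _ ≤ ∑ m ∈ P.divisors, L * rootDensity F m :=
        Finset.sum_le_sum_of_subset_of_nonneg (Finset.filter_subset _ _)
          fun m _ _ => mul_nonneg hL (rootDensity_nonneg F m)
    _ = L * ∏ p ∈ P.primeFactors, (1 + rootDensity F p) := by
        rw [← Finset.mul_sum,
          (isMultiplicative_rootDensity F).prodPrimeFactors_one_add_of_squarefree hPsq]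
    _ ≤ L * ∏ p ∈ Nat.primesBelow ⌈z⌉₊, (1 + rootDensity F p) := by
        refine mul_le_mul_of_nonneg_left (Finset.prod_le_prod_of_subset_of_one_le hsub
          (fun p _ => ?_) (fun p _ _ => ?_)) hL
        · linarith [rootDensity_nonneg F p]
        · linarith [rootDensity_nonneg F p]
    _ ≤ L * (Real.exp (4 * D) * Real.log z ^ D) :=
        mul_le_mul_of_nonneg_left (prod_one_add_rootDensity_le_gen F hD hz) hL

/-- **One root class, sifted** (the upper-bound beta sieve of dimension `2D`, level `w^{18D+1}`,
applied to `{F(n) : n ≤ N, n ≡ s (mod c)}` with the sifting set `P ∣ P(w)` coprime to `c`):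
`#{n ∈ apIndex N c s : (F(n), P) = 1} ≤ (1 + 2K^{10}) (N/c) ∏_{p ∣ P} (1 − ρ(p)/p)
+ w^{18D+1} e^{4D} (log w)^D`. [folklore] -/
theorem card_sifted_class_le (hD : ∀ p : ℕ, p.Prime → polyRootCountMod ![F] p ≤ D) (hD1 : 1 ≤ D)
    {K : ℝ} (hdim : HasSieveDimension (rootDensity F) (2 * (D : ℝ)) K)
    {N c s : ℕ} (hc : 0 < c) {w x : ℝ} (hw : 2 ≤ w) {P : ℕ} (hP : P ∣ primesProdBelow w)
    (hcP : c.Coprime P)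
    (hx : ∀ n ∈ apIndex N c s, 0 < F.eval (n : ℤ) ∧ ((F.eval (n : ℤ) : ℤ) : ℝ) ≤ x) :
    (#((apIndex N c s).filter fun n : ℕ => (F.eval (n : ℤ)).natAbs.Coprime P) : ℝ) ≤
      (1 + 2 * K ^ 10) *
          ((N : ℝ) / c * ∏ p ∈ P.primeFactors, (1 - (polyRootCountMod ![F] p : ℝ) / p)) +
        w ^ (18 * D + 1) * (Real.exp (4 * D) * Real.log w ^ D) := by
  have hdim' : HasSieveDimension (polyAPSeq F N c s).density (2 * (D : ℝ)) K := hdim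
  have hD0 : (0 : ℝ) < D := by exact_mod_cast hD1
  have hκ : (0 : ℝ) < 2 * (D : ℝ) := by positivity
  have hX : 0 ≤ (polyAPSeq F N c s).size x := by rw [polyAPSeq_size]; positivity
  have hw1 : (1 : ℝ) < w := by linarith
  have hlogw : 0 < Real.log w := Real.log_pos hw1
  have hL1 : (1 : ℝ) < w ^ (18 * D + 1) := one_lt_pow₀ hw1 (by omega)
  have hlogL : Real.log (w ^ (18 * D + 1)) = (9 * (2 * (D : ℝ)) + 1) * Real.log w := by
    rw [Real.log_pow]; push_cast; ring
  have hzD : (9 * (2 * (D : ℝ)) + 1) * Real.log w ≤ Real.log (w ^ (18 * D + 1)) := hlogL.ge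
  have hS := SieveSequence.sifted_le_of_dvd_primesProdBelow hdim' hκ hw hL1 hzD hX hP
  have hs : Real.log (w ^ (18 * D + 1)) / Real.log w = 9 * (2 * (D : ℝ)) + 1 := by
    rw [hlogL, mul_div_assoc, div_self hlogw.ne', mul_one]
  rw [hs, sub_self, Real.exp_zero, mul_one, polyAPSeq_sifted F N c s hx, polyAPSeq_size] at hS
  have hV : (polyAPSeq F N c s).densityProduct P =
      ∏ p ∈ P.primeFactors, (1 - (polyRootCountMod ![F] p : ℝ) / p) := rfl
  rw [hV] at hS
  have hR : ∑ d ∈ P.divisors.filter (fun d : ℕ => (d : ℝ) ≤ w ^ (18 * D + 1)),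
      |(polyAPSeq F N c s).remainder d x| ≤
        w ^ (18 * D + 1) * (Real.exp (4 * D) * Real.log w ^ D) :=
    calc ∑ d ∈ P.divisors.filter (fun d : ℕ => (d : ℝ) ≤ w ^ (18 * D + 1)),
            |(polyAPSeq F N c s).remainder d x|
        ≤ ∑ d ∈ P.divisors.filter (fun d : ℕ => (d : ℝ) ≤ w ^ (18 * D + 1)),
            (polyRootCountMod ![F] d : ℝ) := by
          refine Finset.sum_le_sum fun d hd => ?_
          obtain ⟨hdd, -⟩ := Finset.mem_filter.mp hd
          have hdP : d ∣ P := Nat.dvd_of_mem_divisors hdd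
          exact abs_remainder_polyAPSeq_le F hc (Nat.pos_of_mem_divisors hdd)
            (Nat.Coprime.of_dvd_right hdP hcP) hx
      _ ≤ w ^ (18 * D + 1) * (Real.exp (4 * D) * Real.log w ^ D) :=
          sum_rootCount_divisors_le_gen F hD hw (by positivity) hP
  linarith [hS, hR]

/-- **Engine.** For `F` with `ρ(p) ≤ D`, `ρ(p) < p` there are `K₁, K₂ > 0` (depending on `D` only) such that
for all `N`, `c ≥ 1`, `w ≥ 2` with `F > 0` on `[1, N]`:
`#{1 ≤ n ≤ N : c ∣ F(n), p ∤ F(n) for all primes p < w with p ∤ c}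
  ≤ K₁ (N/c) ρ(c) ∏_{p<w, p∤c} (1 − ρ(p)/p) + K₂ ρ(c) w^{18D+1} (log w)^D`
(upper-bound beta sieve of dimension `2D` and level `w^{18D+1}` on each of the `ρ(c)` root classes mod `c`,
remainders `|R_d| ≤ ρ(d)`). [folklore] -/
theorem engine (hD : ∀ p : ℕ, p.Prime → polyRootCountMod ![F] p ≤ D) (hD1 : 1 ≤ D)
    (hfix : ∀ p : ℕ, p.Prime → polyRootCountMod ![F] p < p) :
    ∃ K₁ K₂ : ℝ, 0 < K₁ ∧ 0 < K₂ ∧ ∀ (N c : ℕ), 1 ≤ c → ∀ w : ℝ, 2 ≤ w →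
      (∀ n : ℕ, 1 ≤ n → n ≤ N → 0 < F.eval (n : ℤ)) →
      (#((Icc 1 N).filter fun n : ℕ => (c : ℤ) ∣ F.eval (n : ℤ) ∧
          ∀ p ∈ Nat.primesBelow ⌈w⌉₊, ¬ p ∣ c → ¬ (p : ℤ) ∣ F.eval (n : ℤ)) : ℝ) ≤
        K₁ * ((N : ℝ) / c) * polyRootCountMod ![F] c *
            ∏ p ∈ (Nat.primesBelow ⌈w⌉₊).filter (fun p => ¬ p ∣ c), (1 - (polyRootCountMod ![F] p : ℝ) / p) +
          K₂ * polyRootCountMod ![F] c * w ^ (18 * D + 1) * Real.log w ^ D := by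
  obtain ⟨K, hdim⟩ : ∃ K : ℝ, HasSieveDimension (rootDensity F) (2 * (D : ℝ)) K :=
    ⟨_, BoundedClassDensity.hasSieveDimension_of_card_le (g := rootDensity F)
      (c := fun m => polyRootCountMod ![F] m) (D := D) (fun p _ => rootDensity_apply F p) hD hfix⟩
  refine ⟨1 + 2 * K ^ 10, Real.exp (4 * D), by positivity, Real.exp_pos _, ?_⟩
  intro N c hc w hw hpos
  have hc0 : 0 < c := hc
  -- the sifting set: the primes `< w` not dividing `c`
  have hprime : ∀ p ∈ (Nat.primesBelow ⌈w⌉₊).filter (fun p => ¬ p ∣ c), p.Prime := fun p hp =>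
    Nat.prime_of_mem_primesBelow (Finset.mem_filter.mp hp).1
  obtain ⟨Pc, hPc_def⟩ : ∃ Pc : ℕ, Pc = ∏ p ∈ (Nat.primesBelow ⌈w⌉₊).filter (fun p => ¬ p ∣ c), p :=
    ⟨_, rfl⟩
  have hPc_dvd : Pc ∣ primesProdBelow w := by
    rw [hPc_def, primesProdBelow]
    exact Finset.prod_dvd_prod_of_subset _ _ _ (Finset.filter_subset _ _)
  have hPc_fac : Pc.primeFactors = (Nat.primesBelow ⌈w⌉₊).filter (fun p => ¬ p ∣ c) := by
    rw [hPc_def]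
    exact Nat.primeFactors_prod hprime
  have hPc0 : Pc ≠ 0 := by
    rw [hPc_def]
    exact Finset.prod_ne_zero_iff.mpr fun p hp => (hprime p hp).ne_zero
  have hcPc : c.Coprime Pc := by
    rw [hPc_def]
    exact Nat.Coprime.prod_right fun p hp =>
      ((Nat.Prime.coprime_iff_not_dvd (hprime p hp)).mpr (Finset.mem_filter.mp hp).2).symm
  -- a common height for the (positive) values on `[1, N]`
  obtain ⟨x, hx_def⟩ : ∃ x : ℝ, x = ∑ n ∈ Ioc 0 N, ((F.eval (n : ℤ) : ℤ) : ℝ) := ⟨_, rfl⟩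
  have hx : ∀ s : ℕ, ∀ n ∈ apIndex N c s,
      0 < F.eval (n : ℤ) ∧ ((F.eval (n : ℤ) : ℤ) : ℝ) ≤ x := by
    intro s n hn
    have hn' := Finset.mem_Ioc.mp (apIndex_subset N c s hn)
    refine ⟨hpos n hn'.1 hn'.2, ?_⟩
    rw [hx_def]
    exact Finset.single_le_sum (f := fun m : ℕ => ((F.eval (m : ℤ) : ℤ) : ℝ))
      (fun m hm => by
        have hm' := Finset.mem_Ioc.mp hm
        exact_mod_cast (hpos m hm'.1 hm'.2).le)
      (Finset.mem_Ioc.mpr hn')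
  -- the sieve bound on each root class
  have hclass : ∀ s : ℕ,
      (#((apIndex N c s).filter fun n : ℕ => (F.eval (n : ℤ)).natAbs.Coprime Pc) : ℝ) ≤
        (1 + 2 * K ^ 10) * ((N : ℝ) / c *
            ∏ p ∈ Pc.primeFactors, (1 - (polyRootCountMod ![F] p : ℝ) / p)) +
          w ^ (18 * D + 1) * (Real.exp (4 * D) * Real.log w ^ D) :=
    fun s => card_sifted_class_le F hD hD1 hdim hc0 hw hPc_dvd hcPc (hx s)
  -- decomposition of the target set along the root classes modulo `c`
  have hroots_card : #((range c).filter fun s : ℕ => (c : ℤ) ∣ F.eval (s : ℤ)) =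
      polyRootCountMod ![F] c := card_filter_dvd_eval_eq_polyRootCountMod F c
  have hT : #((Icc 1 N).filter fun n : ℕ => (c : ℤ) ∣ F.eval (n : ℤ) ∧
        ∀ p ∈ Nat.primesBelow ⌈w⌉₊, ¬ p ∣ c → ¬ (p : ℤ) ∣ F.eval (n : ℤ)) =
      ∑ s ∈ (range c).filter (fun s : ℕ => (c : ℤ) ∣ F.eval (s : ℤ)),
        #(((Icc 1 N).filter fun n : ℕ =>
            ∀ p ∈ Nat.primesBelow ⌈w⌉₊, ¬ p ∣ c → ¬ (p : ℤ) ∣ F.eval (n : ℤ)).filter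
          fun n : ℕ => n ≡ s [MOD c]) := by
    rw [← card_filter_dvd_eval_eq_sum F ((Icc 1 N).filter fun n : ℕ =>
        ∀ p ∈ Nat.primesBelow ⌈w⌉₊, ¬ p ∣ c → ¬ (p : ℤ) ∣ F.eval (n : ℤ)) hc0,
      Finset.filter_filter]
    congr 1
    exact Finset.filter_congr fun n _ => and_comm
  have hsub : ∀ s : ℕ,
      (((Icc 1 N).filter fun n : ℕ =>
            ∀ p ∈ Nat.primesBelow ⌈w⌉₊, ¬ p ∣ c → ¬ (p : ℤ) ∣ F.eval (n : ℤ)).filter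
          fun n : ℕ => n ≡ s [MOD c]) ⊆
        (apIndex N c s).filter fun n : ℕ => (F.eval (n : ℤ)).natAbs.Coprime Pc := by
    intro s n hn
    simp only [Finset.mem_filter, Finset.mem_Icc] at hn
    obtain ⟨⟨⟨h1, hN⟩, hQ⟩, hmod⟩ := hn
    refine Finset.mem_filter.mpr ⟨mem_apIndex.mpr ⟨⟨h1, hN⟩, hmod⟩, ?_⟩
    refine Nat.coprime_of_dvd fun k hk hkF hkP => ?_
    have hkmem : k ∈ Pc.primeFactors := Nat.mem_primeFactors.mpr ⟨hk, hkP, hPc0⟩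
    rw [hPc_fac, Finset.mem_filter] at hkmem
    exact hQ k hkmem.1 hkmem.2 (Int.natCast_dvd.mpr hkF)
  calc (#((Icc 1 N).filter fun n : ℕ => (c : ℤ) ∣ F.eval (n : ℤ) ∧
          ∀ p ∈ Nat.primesBelow ⌈w⌉₊, ¬ p ∣ c → ¬ (p : ℤ) ∣ F.eval (n : ℤ)) : ℝ)
      = ∑ s ∈ (range c).filter (fun s : ℕ => (c : ℤ) ∣ F.eval (s : ℤ)),
          (#(((Icc 1 N).filter fun n : ℕ =>
              ∀ p ∈ Nat.primesBelow ⌈w⌉₊, ¬ p ∣ c → ¬ (p : ℤ) ∣ F.eval (n : ℤ)).filter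
            fun n : ℕ => n ≡ s [MOD c]) : ℝ) := by
        rw [hT]; push_cast; rfl
    _ ≤ ∑ _s ∈ (range c).filter (fun s : ℕ => (c : ℤ) ∣ F.eval (s : ℤ)),
          ((1 + 2 * K ^ 10) * ((N : ℝ) / c *
              ∏ p ∈ Pc.primeFactors, (1 - (polyRootCountMod ![F] p : ℝ) / p)) +
            w ^ (18 * D + 1) * (Real.exp (4 * D) * Real.log w ^ D)) :=
        Finset.sum_le_sum fun s _ =>
          le_trans (by exact_mod_cast Finset.card_le_card (hsub s)) (hclass s)
    _ = _ := by
        rw [Finset.sum_const, nsmul_eq_mul, hroots_card, hPc_fac]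
        ring

end Engine

/-- **Registered form** (`--supports stmt-Parity-11292`): the counting engine (upper-bound sieve of dimension 2D on the root classes of c). [folklore] -/
theorem nair_engine : ∀ (F : ℤ[X]) (D : ℕ), (∀ p : ℕ, p.Prime → polyRootCountMod ![F] p ≤ D) → 1 ≤ D → (∀ p : ℕ, p.Prime → polyRootCountMod ![F] p < p) → ∃ K₁ K₂ : ℝ, 0 < K₁ ∧ 0 < K₂ ∧ ∀ (N c : ℕ), 1 ≤ c → ∀ w : ℝ, 2 ≤ w → (∀ n : ℕ, 1 ≤ n → n ≤ N → 0 < F.eval (n : ℤ)) → (#((Icc 1 N).filter fun n : ℕ => (c : ℤ) ∣ F.eval (n : ℤ) ∧ ∀ p ∈ Nat.primesBelow ⌈w⌉₊, ¬ p ∣ c → ¬ (p : ℤ) ∣ F.eval (n : ℤ)) : ℝ) ≤ K₁ * ((N : ℝ) / c) * polyRootCountMod ![F] c * ∏ p ∈ (Nat.primesBelow ⌈w⌉₊).filter (fun p => ¬ p ∣ c), (1 - (polyRootCountMod ![F] p : ℝ) / p) + K₂ * polyRootCountMod ![F] c * w ^ (18 * D + 1) * Real.log w ^ D :=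
  fun F _D hD hD1 hfix => engine F hD hD1 hfix

end

end Summit.Parity.BatemanHorn.Cruxes.SystemLSDRealSegment.BetaThinnedRootKernel.Nair
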